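import Summits.AtomisticToContinuum.BoseEinsteinCondensation.Theorems.BECVortexSheetPeierlsSpatialVillainLRO
import Literature.Probability.LatticeModels.VillainTorusLongRangeOrder
import Literature.Probability.LatticeModels.VillainTorusWormRepresentation

/-!
# Route BECVortexSheetPeierls — `SpatialVillainLRO` (item stmt-AtomisticToContinuum-13468) from the
# Garban–Spencer long-range order on the torus (self-sufficient closing file)

`HomogeneousVillainLRO` (uniform equal-time block long-range order of the homogeneous 3-D Villain
current model on the torus) is assembled from the tree's Garban–Spencer long-range order of the
Villain rotator on the torus (`villain_torus_pairExpect_cosDiff_ge`: `⟨cos(θ_{(πa,0)} − θ_{(πb,0)})⟩ ≥ 1/2`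
for `β ≥ β₁` and `16‖a − b‖₂² < L²`) and the worm representation
(`VillainCurrentModel.twoPoint_homogeneous_eq_ofReal_pairExpect`): every torus site `x` and every
shift `z ∈ {0,…,m}³`, `m = ⌊(L−1)/7⌋`, give a pair `(x, x + πz)` with lifts at squared distance
`≤ 3m² < L²/16`, the shifts are injective mod `L`, so `∑_{x,y} G ≥ L³ (m+1)³ / 2 ≥ L⁶/686`.
`SpatialVillainLRO` then follows by the landed reduction `spatialVillainLRO_of_homogeneousVillainLRO`
(Ginibre/AHPS monotonicity in the bond stiffnesses on the current side).
-/

noncomputable section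

namespace Summit.AtomisticToContinuum.BoseEinsteinCondensation.Theorems

open scoped ENNReal BigOperators
open Literature.Probability.LatticeModels Literature.Probability.LatticeModels.JCurrent
open Summit.AtomisticToContinuum.BoseEinsteinCondensation.Theses.BECVortexSheetPeierls

/-- The integer lift `i ↦ (x i).val` of a torus site projects back to it. [folklore] -/
theorem torusProj_valLift {d L : ℕ} [NeZero L] (x : TorusSite d L) :
    Torus.proj L (fun i => ((x i).val : ℤ)) = x := by
  funext i
  rw [Torus.proj_apply, Int.cast_natCast, ZMod.natCast_zmod_val]

/-- `Torus.proj` is additive. [folklore] -/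
theorem torusProj_add {d L : ℕ} (a b : Site d) : Torus.proj L (a + b) = Torus.proj L a + Torus.proj L b := by
  funext i
  simp only [Torus.proj_apply, Pi.add_apply, Int.cast_add]

/-- **`HomogeneousVillainLRO`** (milestone of route BECVortexSheetPeierls, item
stmt-AtomisticToContinuum-13470's statement) from the tree's Garban–Spencer long-range order of the
Villain rotator on the torus: with `β₁` from `villain_torus_pairExpect_cosDiff_ge` (`d = 3`) and
`c = 1/686`, for all `L ≥ 1` and `β ≥ β₁`,
`ofReal (L⁶/686) ≤ ∑_{x,y} (homogeneous β).twoPoint (x,0) (y,0)`: keep only the pairs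
`(x, x + πz)`, `z ∈ {0,…,⌊(L−1)/7⌋}³` (injective mod `L`, lifts at squared distance `< L²/16`), each
contributing at least `1/2` by the worm representation. [cite: GarbanSpencer2022, Theorem 1.3 with Remark 1 and Remark 10] -/
theorem homogeneousVillainLRO_of_garbanSpencer : HomogeneousVillainLRO := by
  classical
  obtain ⟨β₁, -, H⟩ := villain_torus_pairExpect_cosDiff_ge (d := 3) le_rfl
  refine ⟨β₁, 1 / 686, by norm_num, ?_⟩
  intro L _ β hβ hK
  -- the shifts `z_v = v ∈ {0,…,m}³ ⊂ ℤ³`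
  set m : ℕ := (L - 1) / 7 with hm
  have hL1 : 1 ≤ L := Nat.one_le_iff_ne_zero.2 (NeZero.ne L)
  have h7m : 7 * m + 1 ≤ L := by omega
  have hLm : L ≤ 7 * m + 7 := by omega
  let zv : (Fin 3 → Fin (m + 1)) → Site 3 := fun v i => ((v i : ℕ) : ℤ)
  have hzv_bound : ∀ v i, 0 ≤ zv v i ∧ zv v i ≤ m := fun v i => by
    show (0 : ℤ) ≤ ((v i : ℕ) : ℤ) ∧ ((v i : ℕ) : ℤ) ≤ (m : ℤ)
    exact ⟨by positivity, by exact_mod_cast Nat.lt_succ_iff.1 (v i).isLt⟩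
  -- the pairs `(x, x + π z_v)`
  let pr : TorusSite 3 L → (Fin 3 → Fin (m + 1)) → TorusSite 3 L := fun x v => x + Torus.proj L (zv v)
  have hinj : ∀ x, Function.Injective (pr x) := by
    intro x v w hvw
    have h1 : Torus.proj L (zv v) = Torus.proj L (zv w) := add_left_cancel hvw
    funext i
    have h2 : (((v i : ℕ) : ℤ) : ZMod L) = (((w i : ℕ) : ℤ) : ZMod L) := by
      have := congrFun h1 i
      simpa only [Torus.proj_apply] using this
    have hvi := (v i).isLt
    have hwi := (w i).isLt
    rw [Int.cast_natCast, Int.cast_natCast, ZMod.natCast_eq_natCast_iff',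
      Nat.mod_eq_of_lt (by omega : (v i : ℕ) < L), Nat.mod_eq_of_lt (by omega : (w i : ℕ) < L)] at h2
    exact Fin.ext h2
  -- each such pair has two-point function at least `1/2`
  set P : VillainCurrentModel 3 L 1 :=
    VillainCurrentModel.homogeneous (fun _ => β) (fun _ => hβ) with hPdef
  have hpair : ∀ x v, ENNReal.ofReal (1 / 2) ≤ P.twoPoint (x, 0) (pr x v, 0) := by
    intro x v
    rw [hPdef, VillainCurrentModel.twoPoint_homogeneous_eq_ofReal_pairExpect hβ]
    refine ENNReal.ofReal_le_ofReal ?_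
    -- lifts `a = val-lift of x`, `b = a + z_v`
    set a : Site 3 := fun i => ((x i).val : ℤ) with ha
    have hpa : Torus.proj L a = x := torusProj_valLift x
    have hpb : Torus.proj L (a + zv v) = pr x v := by
      show Torus.proj L (a + zv v) = x + Torus.proj L (zv v)
      rw [torusProj_add, hpa]
    have hdist : 16 * ∑ i, ((a i : ℝ) - ((a + zv v) i : ℝ)) ^ 2 < (L : ℝ) ^ 2 := by
      have hterm : ∀ i, ((a i : ℝ) - ((a + zv v) i : ℝ)) ^ 2 ≤ (m : ℝ) ^ 2 := by
        intro i
        have h0 := (hzv_bound v i).1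
        have h1 := (hzv_bound v i).2
        have h2 : ((a i : ℝ) - ((a + zv v) i : ℝ)) ^ 2 = ((zv v i : ℤ) : ℝ) ^ 2 := by
          simp only [Pi.add_apply, Int.cast_add]
          ring
        rw [h2]
        have h3 : (0 : ℝ) ≤ ((zv v i : ℤ) : ℝ) := by exact_mod_cast h0
        have h4 : ((zv v i : ℤ) : ℝ) ≤ (m : ℝ) := by exact_mod_cast h1
        nlinarith
      have hsum : ∑ i, ((a i : ℝ) - ((a + zv v) i : ℝ)) ^ 2 ≤ 3 * (m : ℝ) ^ 2 := by
        calc ∑ i, ((a i : ℝ) - ((a + zv v) i : ℝ)) ^ 2 ≤ ∑ _i : Fin 3, (m : ℝ) ^ 2 :=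
              Finset.sum_le_sum fun i _ => hterm i
          _ = 3 * (m : ℝ) ^ 2 := by simp
      have hL : (7 * (m : ℝ) + 1) ≤ (L : ℝ) := by exact_mod_cast h7m
      nlinarith [sq_nonneg (m : ℝ)]
    have := H β hK L 1 a (a + zv v) hdist
    rwa [hpa, hpb] at this
  -- count: `∑_{x,y} ≥ ∑_x ∑_v 1/2 = L³ (m+1)³ / 2 ≥ L⁶/686`
  have hcardT : Fintype.card (TorusSite 3 L) = L ^ 3 := by
    rw [Fintype.card_pi, Finset.prod_const, ZMod.card, Finset.card_univ, Fintype.card_fin]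
  have hcardV : Fintype.card (Fin 3 → Fin (m + 1)) = (m + 1) ^ 3 := by
    rw [Fintype.card_pi, Finset.prod_const, Finset.card_univ, Fintype.card_fin, Fintype.card_fin]
  calc ENNReal.ofReal (1 / 686 * (L : ℝ) ^ 6)
      ≤ ENNReal.ofReal ((Fintype.card (TorusSite 3 L) : ℝ) *
          ((Fintype.card (Fin 3 → Fin (m + 1)) : ℝ) * (1 / 2))) := by
        refine ENNReal.ofReal_le_ofReal ?_
        rw [hcardT, hcardV]
        push_cast
        have hLm' : (L : ℝ) ≤ 7 * ((m : ℝ) + 1) := by exact_mod_cast (by omega : L ≤ 7 * (m + 1))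
        have hL0 : (0 : ℝ) ≤ L := Nat.cast_nonneg L
        have h3 : (L : ℝ) ^ 3 ≤ 343 * ((m : ℝ) + 1) ^ 3 := by
          have := pow_le_pow_left₀ hL0 hLm' 3
          nlinarith [this]
        nlinarith [pow_nonneg hL0 3]
    _ = ∑ _x : TorusSite 3 L, ∑ _v : Fin 3 → Fin (m + 1), ENNReal.ofReal (1 / 2) := by
        rw [Finset.sum_const, Finset.sum_const, nsmul_eq_mul, nsmul_eq_mul, Finset.card_univ,
          Finset.card_univ, ← mul_assoc, ENNReal.ofReal_mul (by positivity),
          ENNReal.ofReal_mul (by positivity), ENNReal.ofReal_natCast, ENNReal.ofReal_natCast, mul_assoc]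
    _ ≤ ∑ x : TorusSite 3 L, ∑ v : Fin 3 → Fin (m + 1), P.twoPoint (x, 0) (pr x v, 0) :=
        Finset.sum_le_sum fun x _ => Finset.sum_le_sum fun v _ => hpair x v
    _ = ∑ x : TorusSite 3 L, ∑ y ∈ (Finset.univ.image (pr x)), P.twoPoint (x, 0) (y, 0) := by
        refine Finset.sum_congr rfl fun x _ => ?_
        rw [Finset.sum_image fun v _ w _ h => hinj x h]
    _ ≤ ∑ x : TorusSite 3 L, ∑ y : TorusSite 3 L, P.twoPoint (x, 0) (y, 0) :=
        Finset.sum_le_sum fun x _ => Finset.sum_le_sum_of_subset (Finset.subset_univ _)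

/-- Settles `stmt-AtomisticToContinuum-13468` (exact signature): `SpatialVillainLRO` of route
BECVortexSheetPeierls, from `homogeneousVillainLRO_of_garbanSpencer` by the landed reduction
`spatialVillainLRO_of_homogeneousVillainLRO` (monotonicity in the bond stiffnesses).
[cite: GarbanSpencer2022, Theorem 1.3 with Remark 1 and Remark 10] -/
theorem spatialVillainLRO_proof_gs : SpatialVillainLRO :=
  spatialVillainLRO_of_homogeneousVillainLRO homogeneousVillainLRO_of_garbanSpencer

end Summit.AtomisticToContinuum.BoseEinsteinCondensation.Theorems

end
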